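import Summits.QuantumFields.YangMills.Theorems.BalabanUVNodesN11NoExpansionStepReductionCoPH
import Summits.QuantumFields.YangMills.Theorems.BalabanUVNodesN11NoExpansionOldBranchIntegrable

/-!
# DAG node N11 — THEOREM 1's INDUCTIVE STEP AT THE v1.7 `CoPH` RECORD REDUCED TO THE EXPANSION SEQUENCES, INTEGRABLE FORM: this seat's `…NoExpansionStepReductionCoPH`
# (p552803) with the old-branch SUP BOUND `hCB` — dag-n11-d's located analytic row (a bound through `margDensity` of the exp-mean-log averaging, for which the tree has
# absolute continuity only) — RE-TYPED to INTEGRABILITY `hIB` against the one-step law, over dag-n11-d's `…N11NoExpansionOldBranchIntegrable`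

Cell `pub-ymgap`, YM-PLAN Track A (HUMAN RULING D-0062), seat `pub-ymgap-dag-n11-e` (g13; R134 fan-out row N11∕s3), route `BalabanUVNodes` rev 25 (v1.7 `CoPH` key), item K1⁷
`StabilityBAtRecordR13SepCoPH` = stmt-QuantumFields-20542 (helper lane, count-neutral).  [III] = [Balaban1988Convergent], [IV] = [Balaban1989LargeFieldI].

WHY THIS FILE.  p552803 reduces `TLaw₁₃CoPH θ p k` (and, on the live-selector line, `SLaw₁₃CoPH θ p (k+1)`) to the displayed hypothesis `hexp` on the expansion sequences plus, along
the no-expansion sequences, the new universal 𝐄-terms' r11 clauses, dag-n11-d's residual-slot binders, `hA`, and the two old-branch rows of p547524: measurability `hmB` and a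
uniform bound `hCB`.  dag-n11-d has located `hCB` as mis-typed (no sup bound is available through `margDensity`; the kernel needs it only for integrability of sections) and
re-typed the whole chain g2 → g3 → p543015 → p543804 → p544575 → p547524 to graph-integrability (`…TkFullBondTransportIntegrable`, `…TkNoExpansionSumTransportIntegrable`,
`…NoExpansionGeneralStepIntegrable`, `…NoExpansionGenericWIntegrable`, `…NoExpansionOldBranchIntegrable`): the old-branch step now asks `hIB : ∀ S ∈ admS k (init s′), Integrable
(U₀ ↦ 𝐓_k(init s′, S)[e^{A_k(init s′)}]_S(U₀)) (fieldMeasure k)` — the currency in which the row IS dischargeable (along the diagonal by mass preservation,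
`…DiagonalStepNoBinders`).  This file carries the re-typing through p552803: same proofs, one callee swapped.  HENCE:
§1 ★★★ `tLaw₁₃CoPH_of_formAtZS_of_newTerms_of_expansion_of_integrable` · ★★★ `sLaw₁₃CoPH_succ_of_formAtZS_of_newTerms_of_expansion_of_liveSel_of_integrable` — p552803's two
   theorems VERBATIM with `(C, hCB) ↦ hIB`.

HONEST FRAMING.  Count-neutral kernel bookkeeping; `hexp` — the load-bearing (S1ᵀ) content ([III] Sect. 1 ∕ §3 ∕ Thm 2 at `Ω_{k+1} ≠ ∅`) — is DISPLAYED, not proved; the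
residual-slot binders, `hA`, `hmB`, `hIB` stay displayed (inhabited at `rePinH θ` ∕ along the diagonal by dag-n11-d's files and this seat's `…RePinned*` ∕ `…NoBinders*`
companions); nothing of Bałaban asserted; N11 NOT discharged; K1⁷ NOT closed; counts unmoved (typed 28∕28 · discharged 5∕27).  One finite `𝕋⁴_{L^K}` programme at fixed
`ε = L^{−K}`; NOT ℝ⁴, NOT OS, NOT a mass gap, NOT Clay.
Sources: [III] Theorem p.245, Thm 1 p.262, §2 p.262, (2.17)–(2.18) p.257, (2.20)–(2.31) pp.258–260, (2.40)–(2.42) p.261, (3.1) p.264, (3.16) p.268, (3.24)–(3.25) p.270, p.279;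
[IV] (0.2)–(0.4) p.176, p.177 (i)–(ii); [Balaban1987RG1] (0.20) p.256.
-/

noncomputable section

open MeasureTheory
open scoped BigOperators Matrix.Norms.L2Operator

namespace Summit.QuantumFields.YangMills.Theorems.BalabanUVNodesN11NoExpansionStepReductionIntegrableCoPH

open Literature.MathematicalPhysics.QuantumFieldTheory.Balaban1983to89 T4Continuum Node00 Node00.Tk DagBinding
open Literature.MathematicalPhysics.QuantumFieldTheory.Balaban1983to89.B16RLeafRecord13LiveCoPH (sLaw₁₃CoPH_succ_of_tLaw₁₃CoPH_of_liveSel_of_rstep)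
open BalabanUVNodesN11NoExpansionTruncatedWitness (sect2Slot_succ_congr_of_agree_of_Omega_empty)
open BalabanUVNodesN11NoExpansionGeneralStepLawsCoPH (sect2TowerOfRecord_rzAt_succ_eq_init_of_Omega_empty)
open BalabanUVNodesN11NoExpansionStepReductionCoPH (lawsT_towerOfTerms_of_lawsRT_of_agree_of_newE)
open BalabanUVNodesN11NoExpansionOldBranchIntegrable (clause_succ_CoPH_of_Omega_empty_of_pinChi_of_oldBranch_of_clause_of_integrable)

/-! ## §1. `TLaw₁₃CoPH θ p k` and `SLaw₁₃CoPH θ p (k+1)` reduced to the expansion sequences — old-branch rows: measurability and INTEGRABILITY -/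

section Reduction

variable {F : T4Family} {N : ℕ} [NeZero N]
variable (θ : Stage13HParams F N) (p : B12.RunParams)

/-- **★★★ `TLaw₁₃CoPH θ p k` REDUCED TO THE EXPANSION SEQUENCES, INTEGRABLE FORM** (p552803's theorem with the old-branch SUP BOUND `hCB` RE-TYPED to INTEGRABILITY `hIB` — dag-n11-d's
`clause_succ_CoPH_of_Omega_empty_of_pinChi_of_oldBranch_of_clause_of_integrable` is the no-expansion step).  As there: the candidate family `(tT, EkT)`
(universal in 𝐄, old terms of `(t, E_k)` kept at the no-expansion `s′`, no new `𝐑 ∕ 𝐁` there, new universal `𝐄^{(k+1)}` obeying r11's new-term clauses there, `E_{k+1}(s′) =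
E_k(init s′)` there) IS a witness of `TLaw₁₃CoPH θ p k` as soon as it serves the sequences with `Ω_{k+1}(s′) ≠ ∅` (`hexp`, [III] §3 proper, displayed) — the no-expansion
sequences are served by p552803 §0 (laws) and by dag-n11-d's integrable old-branch step for `t (init s′)` read at `tT s′` through p549689's slot invariance (clause).
[cite: Balaban1988Convergent, Theorem p.245, Thm 1 p.262, §2 p.262, (3.24)–(3.25) p.270, (2.18) p.257, (2.20)–(2.31) pp.258–260, (2.40)–(2.42) p.261, (3.1) p.264, p.279; Balaban1989LargeFieldI, (0.2)–(0.3) p.176; Balaban1987RG1, (0.20) p.256] -/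
theorem tLaw₁₃CoPH_of_formAtZS_of_newTerms_of_expansion_of_integrable (h : θ.Provisos₁₃CoPH F N) {k : ℕ} (hk : k < p.K) (hM : 1 ≤ θ.τ9.M) (hB₀ : 0 ≤ θ.s2.lf.B₀)
    (t : SeqOfRecord F θ.ν θ.τ9.M (gOfRecord₁₃ F N θ.toStage13Params p) p.K k → Sect2.TermValues (F.P p.K) (MatA N) (FluctV N) θ.τ9.M)
    (Ek : SeqOfRecord F θ.ν θ.τ9.M (gOfRecord₁₃ F N θ.toStage13Params p) p.K k → ℝ)
    (hS : HasSect2FormAtZS F N (FluctV N) p.K (settingOfRecord₁₃ F N θ.toStage13Params p) k (θ.rzAt p) (WtOfRecord₁₃H F N θ p)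
      (UbgOfRecord₁₃CoP F N θ.toStage13Params p k)
      (fun s u => Sect2.LawsRT (sect2TowerOfRecord F N (FluctV N) p.K (settingOfRecord₁₃ F N θ.toStage13Params p) (θ.rzAt p s) s u)
        (settingOfRecord₁₃ F N θ.toStage13Params p).lf k)
      (slotsOfRecord F N θ.ν θ.τ9 (EOfRecord₁₃ F N θ.toStage13Params) (wOfRecord₉ F N θ.toStage9Params) θ.ppSel p (gOfRecord₁₃ F N θ.toStage13Params p) k) t Ek)
    (tT : SeqOfRecord F θ.ν θ.τ9.M (gOfRecord₁₃ F N θ.toStage13Params p) p.K (k + 1) → Sect2.TermValues (F.P p.K) (MatA N) (FluctV N) θ.τ9.M)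
    (EkT : SeqOfRecord F θ.ν θ.τ9.M (gOfRecord₁₃ F N θ.toStage13Params p) p.K (k + 1) → ℝ) (huT : Sect2.UniversalE tT)
    (hold : ∀ s : SeqOfRecord F θ.ν θ.τ9.M (gOfRecord₁₃ F N θ.toStage13Params p) p.K (k + 1), s.Ω (k + 1) = ∅ →
      (∀ j, j ≤ k → ∀ X z g φ, (tT s).E j X z g φ = (t s.init).E j X z g φ) ∧ (∀ j, j ≤ k → ∀ X φ, (tT s).R j X φ = (t s.init).R j X φ) ∧
        (∀ j, j ≤ k → ∀ X φ a, (tT s).B j X φ a = (t s.init).B j X φ a))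
    (hnoR : ∀ s : SeqOfRecord F θ.ν θ.τ9.M (gOfRecord₁₃ F N θ.toStage13Params p) p.K (k + 1), s.Ω (k + 1) = ∅ → ∀ X φ, (tT s).R (k + 1) X φ = 0)
    (hnoB : ∀ s : SeqOfRecord F θ.ν θ.τ9.M (gOfRecord₁₃ F N θ.toStage13Params p) p.K (k + 1), s.Ω (k + 1) = ∅ → ∀ X φ a, (tT s).B (k + 1) X φ a = 0)
    (hlocE : ∀ s : SeqOfRecord F θ.ν θ.τ9.M (gOfRecord₁₃ F N θ.toStage13Params p) p.K (k + 1), s.Ω (k + 1) = ∅ → ∀ X z g φ ψ,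
      (sect2TowerOfRecord F N (FluctV N) p.K (settingOfRecord₁₃ F N θ.toStage13Params p) (θ.rzAt p s) s (tT s)).agreeOn (k + 1) X φ ψ →
        (tT s).E (k + 1) X z g φ = (tT s).E (k + 1) X z g ψ)
    (hinvE : ∀ s : SeqOfRecord F θ.ν θ.τ9.M (gOfRecord₁₃ F N θ.toStage13Params p) p.K (k + 1), s.Ω (k + 1) = ∅ → ∀ X z g u φ,
      (tT s).E (k + 1) X z g ((sect2TowerOfRecord F N (FluctV N) p.K (settingOfRecord₁₃ F N θ.toStage13Params p) (θ.rzAt p s) s (tT s)).act u φ) = (tT s).E (k + 1) X z g φ)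
    (hbdE : ∀ s : SeqOfRecord F θ.ν θ.τ9.M (gOfRecord₁₃ F N θ.toStage13Params p) p.K (k + 1), s.Ω (k + 1) = ∅ → ∀ X z g φ, 0 ≤ g →
      g ≤ (settingOfRecord₁₃ F N θ.toStage13Params p).lf.γ →
      φ ∈ (sect2TowerOfRecord F N (FluctV N) p.K (settingOfRecord₁₃ F N θ.toStage13Params p) (θ.rzAt p s) s (tT s)).space (k + 1) X
        ((settingOfRecord₁₃ F N θ.toStage13Params p).lf.alpha0 ((settingOfRecord₁₃ F N θ.toStage13Params p).flow.g (k + 1)))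
        ((settingOfRecord₁₃ F N θ.toStage13Params p).lf.alpha1 ((settingOfRecord₁₃ F N θ.toStage13Params p).flow.g (k + 1))) →
      ‖(tT s).E (k + 1) X z g φ‖ ≤ (settingOfRecord₁₃ F N θ.toStage13Params p).lf.E₀ *
        Real.exp (-((1 + 4 * (settingOfRecord₁₃ F N θ.toStage13Params p).βc) * (settingOfRecord₁₃ F N θ.toStage13Params p).lf.κ) *
          (Sect2.domSys (F.P p.K) θ.τ9.M (k + 1)).dj X))
    (hanE : ∀ s : SeqOfRecord F θ.ν θ.τ9.M (gOfRecord₁₃ F N θ.toStage13Params p) p.K (k + 1), s.Ω (k + 1) = ∅ → ∀ X z g, 0 ≤ g →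
      g ≤ (settingOfRecord₁₃ F N θ.toStage13Params p).lf.γ →
      AnalyticOnNhd ℂ ((tT s).E (k + 1) X z g)
        ((sect2TowerOfRecord F N (FluctV N) p.K (settingOfRecord₁₃ F N θ.toStage13Params p) (θ.rzAt p s) s (tT s)).space (k + 1) X
          ((settingOfRecord₁₃ F N θ.toStage13Params p).lf.alpha0 ((settingOfRecord₁₃ F N θ.toStage13Params p).flow.g (k + 1)))
          ((settingOfRecord₁₃ F N θ.toStage13Params p).lf.alpha1 ((settingOfRecord₁₃ F N θ.toStage13Params p).flow.g (k + 1)))))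
    (hEk : ∀ s : SeqOfRecord F θ.ν θ.τ9.M (gOfRecord₁₃ F N θ.toStage13Params p) p.K (k + 1), s.Ω (k + 1) = ∅ → EkT s = Ek s.init)
    (hqloc : ∀ s : SeqOfRecord F θ.ν θ.τ9.M (gOfRecord₁₃ F N θ.toStage13Params p) p.K (k + 1), s.Ω (k + 1) = ∅ →
      ∀ j, j < k → ∀ ω ω' : MultiCfg (F.P p.K) (SU N) (FluctV N), (∀ i, i ≤ k → ω i = ω' i) →
        (θ.zhAt p s).quad j (s.init.Λ (j + 1)) ω = (θ.zhAt p s).quad j (s.init.Λ (j + 1)) ω')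
    (hpre : ∀ s : SeqOfRecord F θ.ν θ.τ9.M (gOfRecord₁₃ F N θ.toStage13Params p) p.K (k + 1), s.Ω (k + 1) = ∅ →
      ∀ j, j < k → (θ.zhAt p s).ζ0 j = (θ.zhAt p s.init).ζ0 j ∧ (θ.zhAt p s).quad j = (θ.zhAt p s.init).quad j)
    (hA : ∀ s : SeqOfRecord F θ.ν θ.τ9.M (gOfRecord₁₃ F N θ.toStage13Params p) p.K (k + 1), s.Ω (k + 1) = ∅ →
      ∀ (S : ℕ → Set (Site (F.P p.K) 0)) (a a' : Tk.MSFluct (F.P p.K) (FluctV N)) (Uf : GaugeField (F.P p.K) 0 (SU N)), (∀ i, i ≤ k → a i = a' i) →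
      (sect2ActionDataOfRecord F N (FluctV N) p.K (settingOfRecord₁₃ F N θ.toStage13Params p) (θ.rzAt p s.init) s.init (t s.init) (S, a) (Ek s.init)).action23 k Uf =
        (sect2ActionDataOfRecord F N (FluctV N) p.K (settingOfRecord₁₃ F N θ.toStage13Params p) (θ.rzAt p s.init) s.init (t s.init) (S, a') (Ek s.init)).action23 k Uf)
    (hZ : ∀ s : SeqOfRecord F θ.ν θ.τ9.M (gOfRecord₁₃ F N θ.toStage13Params p) p.K (k + 1), s.Ω (k + 1) = ∅ →
      ∀ (V' : GaugeField (F.P p.K) (k + 1) (SU N)) (U₀ : GaugeField (F.P p.K) k (SU N)),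
      (θ.zhAt p s).ζ0 k Set.univ (pairCfgAt (V := FluctV N) k V' U₀) =
        chiSeqOfRecord F N θ.ν θ.τ9.M (gOfRecord₁₃ F N θ.toStage13Params p) p.K k s.init U₀ *
          wOfRecord₉ F N θ.toStage9Params p (gOfRecord₁₃ F N θ.toStage13Params p) k s U₀ ((avOfRecord F N p.K k).avg U₀))
    (hq : ∀ s : SeqOfRecord F θ.ν θ.τ9.M (gOfRecord₁₃ F N θ.toStage13Params p) p.K (k + 1), s.Ω (k + 1) = ∅ →
      ∀ (V' : GaugeField (F.P p.K) (k + 1) (SU N)) (U₀ : GaugeField (F.P p.K) k (SU N)), (θ.zhAt p s).quad k ∅ (pairCfgAt (V := FluctV N) k V' U₀) = 0)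
    (hmB : ∀ s : SeqOfRecord F θ.ν θ.τ9.M (gOfRecord₁₃ F N θ.toStage13Params p) p.K (k + 1), s.Ω (k + 1) = ∅ →
      ∀ S ∈ admSOfRecord F θ.ν θ.τ9.M (gOfRecord₁₃ F N θ.toStage13Params p) p.K k s.init,
      Measurable fun U₀ : GaugeField (F.P p.K) k (SU N) =>
        tkBranchOfRecord F N (FluctV N) θ.ν θ.τ9.M _ p.K (WtOfRecord₁₃H F N θ p s) s.init S k
          (fun ω => sect2Operand F N (FluctV N) p.K (settingOfRecord₁₃ F N θ.toStage13Params p) (θ.rzAt p s.init) s.init (t s.init) (Ek s.init)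
            (UbgOfRecord₁₃CoP F N θ.toStage13Params p k s.init) (S, fun j => (ω j).2) (fun j => (ω j).1))
          (baseCfg (V := FluctV N) k U₀))
    (hIB : ∀ s : SeqOfRecord F θ.ν θ.τ9.M (gOfRecord₁₃ F N θ.toStage13Params p) p.K (k + 1), s.Ω (k + 1) = ∅ →
      ∀ S ∈ admSOfRecord F θ.ν θ.τ9.M (gOfRecord₁₃ F N θ.toStage13Params p) p.K k s.init,
      Integrable (fun U₀ : GaugeField (F.P p.K) k (SU N) =>
        tkBranchOfRecord F N (FluctV N) θ.ν θ.τ9.M _ p.K (WtOfRecord₁₃H F N θ p s) s.init S k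
          (fun ω => sect2Operand F N (FluctV N) p.K (settingOfRecord₁₃ F N θ.toStage13Params p) (θ.rzAt p s.init) s.init (t s.init) (Ek s.init)
            (UbgOfRecord₁₃CoP F N θ.toStage13Params p k s.init) (S, fun j => (ω j).2) (fun j => (ω j).1))
          (baseCfg (V := FluctV N) k U₀)) (fieldMeasure (F.P p.K) k (SU N)))
    (hexp : ∀ s : SeqOfRecord F θ.ν θ.τ9.M (gOfRecord₁₃ F N θ.toStage13Params p) p.K (k + 1), s.Ω (k + 1) ≠ ∅ →
      Sect2.LawsT (sect2TowerOfRecord F N (FluctV N) p.K (settingOfRecord₁₃ F N θ.toStage13Params p) (θ.rzAt p s) s (tT s))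
          (settingOfRecord₁₃ F N θ.toStage13Params p).lf (settingOfRecord₁₃ F N θ.toStage13Params p).βc k ∧
        (slotsTOfRecord F N θ.ν θ.τ9 (EOfRecord₁₃ F N θ.toStage13Params) (wOfRecord₉ F N θ.toStage9Params) θ.ppSel p
            (gOfRecord₁₃ F N θ.toStage13Params p) (k + 1) s = 0 ∨
          ∀ᵐ V' ∂fieldMeasure (F.P p.K) (k + 1) (SU N),
            chiSeqOfRecord F N θ.ν θ.τ9.M (gOfRecord₁₃ F N θ.toStage13Params p) p.K (k + 1) s V' ≠ 0 →
              slotsTOfRecord F N θ.ν θ.τ9 (EOfRecord₁₃ F N θ.toStage13Params) (wOfRecord₉ F N θ.toStage9Params) θ.ppSel p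
                  (gOfRecord₁₃ F N θ.toStage13Params p) (k + 1) s V' =
                sect2Slot F N (FluctV N) p.K (settingOfRecord₁₃ F N θ.toStage13Params p) (θ.rzAt p s) (WtOfRecord₁₃H F N θ p s) s (tT s) (EkT s)
                  (UbgOfRecord₁₃CoP F N θ.toStage13Params p (k + 1) s) V')) :
    TLaw₁₃CoPH F N θ p k := by
  obtain ⟨-, hs⟩ := hS
  refine (tLaw₁₃CoPH_iff F N θ p k).mpr ⟨tT, EkT, huT, fun s => ?_⟩
  by_cases hΩ : s.Ω (k + 1) = ∅
  · -- NO-EXPANSION new sequence: §0 for the laws, dag-n11-d's old-branch step read at `tT s` for the clause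
    obtain ⟨hE, hR, hB⟩ := hold s hΩ
    have htw := sect2TowerOfRecord_rzAt_succ_eq_init_of_Omega_empty θ p s hΩ (t s.init)
    have hlaw : Sect2.LawsRT (sect2TowerOfRecord F N (FluctV N) p.K (settingOfRecord₁₃ F N θ.toStage13Params p) (θ.rzAt p s) s (t s.init))
        (settingOfRecord₁₃ F N θ.toStage13Params p).lf k := by
      rw [htw]; exact (hs s.init).1
    refine ⟨lawsT_towerOfTerms_of_lawsRT_of_agree_of_newE _ _ _ hE hR hB (hnoR s hΩ) (hnoB s hΩ) (hlocE s hΩ) (hinvE s hΩ) (hbdE s hΩ) (hanE s hΩ)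
      hlaw (settingOfRecord₁₃_satisfiesRG F N θ.toStage13Params p (k + 1) k (Nat.lt_succ_self k)) hB₀
      (B16RLeafRecord13Live.gOfRecord₁₃_succ_nonneg F N θ.toStage13Params p k), ?_⟩
    rw [hEk s hΩ, sect2Slot_succ_congr_of_agree_of_Omega_empty (FluctV N) _ _ _ hM s hΩ hE hR hB]
    exact clause_succ_CoPH_of_Omega_empty_of_pinChi_of_oldBranch_of_clause_of_integrable θ p h hk hM s hΩ (hqloc s hΩ) (hpre s hΩ) (t s.init) (Ek s.init)
      (hA s hΩ) (hs s.init).2 (hZ s hΩ) (hq s hΩ) (hmB s hΩ) (hIB s hΩ)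
  · -- EXPANSION new sequence: [III] §3 proper, displayed
    exact hexp s hΩ

/-- **★★★ … HENCE `SLaw₁₃CoPH θ p (k+1)` ON THE LIVE-SELECTOR LINE, INTEGRABLE FORM** — Theorem 1's complete inductive step `ρ_k ↦ ρ_{k+1}` at the v1.7 record from the same inputs plus
node00-def-T's selector clause, admissibility and the signs `0 ≤ κ, E₀` (this seat's `…LiveCoPH.sLaw₁₃CoPH_succ_of_tLaw₁₃CoPH_of_liveSel_of_rstep`: 𝐑 of record moves only dead
sequences).  MODULO EXACTLY: `hexp` (the expansion sequences), the new universal 𝐄-terms' clauses, and dag-n11-d's displayed no-expansion binders — (P)∕(V)∕`hq`∕`hqloc`, `hA`,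
and the old-branch rows `hmB` (measurability) ∕ `hIB` (integrability). [cite: Balaban1988Convergent, Thm 1 p.262, Theorem p.245, §2 p.262, (3.24)–(3.25) p.270, (2.17)–(2.18) p.257, (3.1) p.264, p.279; Balaban1989LargeFieldI, (0.2)–(0.4) p.176, p.177 (i)–(ii)] -/
theorem sLaw₁₃CoPH_succ_of_formAtZS_of_newTerms_of_expansion_of_liveSel_of_integrable (h : θ.Provisos₁₃CoPH F N)
    (hsel : θ.ppSel = ppSelLiveOfRecord F N θ.ν θ.τ9 (EOfRecord₁₃ F N θ.toStage13Params) (wOfRecord₉ F N θ.toStage9Params))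
    (hθ : θ.Admissible F N) (hκ : 0 ≤ θ.s2.lf.κ) (hE₀ : 0 ≤ θ.s2.lf.E₀) (hB₀ : 0 ≤ θ.s2.lf.B₀) {k : ℕ} (hk : k < p.K) (hM : 1 ≤ θ.τ9.M)
    (t : SeqOfRecord F θ.ν θ.τ9.M (gOfRecord₁₃ F N θ.toStage13Params p) p.K k → Sect2.TermValues (F.P p.K) (MatA N) (FluctV N) θ.τ9.M)
    (Ek : SeqOfRecord F θ.ν θ.τ9.M (gOfRecord₁₃ F N θ.toStage13Params p) p.K k → ℝ)
    (hS : HasSect2FormAtZS F N (FluctV N) p.K (settingOfRecord₁₃ F N θ.toStage13Params p) k (θ.rzAt p) (WtOfRecord₁₃H F N θ p)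
      (UbgOfRecord₁₃CoP F N θ.toStage13Params p k)
      (fun s u => Sect2.LawsRT (sect2TowerOfRecord F N (FluctV N) p.K (settingOfRecord₁₃ F N θ.toStage13Params p) (θ.rzAt p s) s u)
        (settingOfRecord₁₃ F N θ.toStage13Params p).lf k)
      (slotsOfRecord F N θ.ν θ.τ9 (EOfRecord₁₃ F N θ.toStage13Params) (wOfRecord₉ F N θ.toStage9Params) θ.ppSel p (gOfRecord₁₃ F N θ.toStage13Params p) k) t Ek)
    (tT : SeqOfRecord F θ.ν θ.τ9.M (gOfRecord₁₃ F N θ.toStage13Params p) p.K (k + 1) → Sect2.TermValues (F.P p.K) (MatA N) (FluctV N) θ.τ9.M)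
    (EkT : SeqOfRecord F θ.ν θ.τ9.M (gOfRecord₁₃ F N θ.toStage13Params p) p.K (k + 1) → ℝ) (huT : Sect2.UniversalE tT)
    (hold : ∀ s : SeqOfRecord F θ.ν θ.τ9.M (gOfRecord₁₃ F N θ.toStage13Params p) p.K (k + 1), s.Ω (k + 1) = ∅ →
      (∀ j, j ≤ k → ∀ X z g φ, (tT s).E j X z g φ = (t s.init).E j X z g φ) ∧ (∀ j, j ≤ k → ∀ X φ, (tT s).R j X φ = (t s.init).R j X φ) ∧
        (∀ j, j ≤ k → ∀ X φ a, (tT s).B j X φ a = (t s.init).B j X φ a))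
    (hnoR : ∀ s : SeqOfRecord F θ.ν θ.τ9.M (gOfRecord₁₃ F N θ.toStage13Params p) p.K (k + 1), s.Ω (k + 1) = ∅ → ∀ X φ, (tT s).R (k + 1) X φ = 0)
    (hnoB : ∀ s : SeqOfRecord F θ.ν θ.τ9.M (gOfRecord₁₃ F N θ.toStage13Params p) p.K (k + 1), s.Ω (k + 1) = ∅ → ∀ X φ a, (tT s).B (k + 1) X φ a = 0)
    (hlocE : ∀ s : SeqOfRecord F θ.ν θ.τ9.M (gOfRecord₁₃ F N θ.toStage13Params p) p.K (k + 1), s.Ω (k + 1) = ∅ → ∀ X z g φ ψ,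
      (sect2TowerOfRecord F N (FluctV N) p.K (settingOfRecord₁₃ F N θ.toStage13Params p) (θ.rzAt p s) s (tT s)).agreeOn (k + 1) X φ ψ →
        (tT s).E (k + 1) X z g φ = (tT s).E (k + 1) X z g ψ)
    (hinvE : ∀ s : SeqOfRecord F θ.ν θ.τ9.M (gOfRecord₁₃ F N θ.toStage13Params p) p.K (k + 1), s.Ω (k + 1) = ∅ → ∀ X z g u φ,
      (tT s).E (k + 1) X z g ((sect2TowerOfRecord F N (FluctV N) p.K (settingOfRecord₁₃ F N θ.toStage13Params p) (θ.rzAt p s) s (tT s)).act u φ) = (tT s).E (k + 1) X z g φ)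
    (hbdE : ∀ s : SeqOfRecord F θ.ν θ.τ9.M (gOfRecord₁₃ F N θ.toStage13Params p) p.K (k + 1), s.Ω (k + 1) = ∅ → ∀ X z g φ, 0 ≤ g →
      g ≤ (settingOfRecord₁₃ F N θ.toStage13Params p).lf.γ →
      φ ∈ (sect2TowerOfRecord F N (FluctV N) p.K (settingOfRecord₁₃ F N θ.toStage13Params p) (θ.rzAt p s) s (tT s)).space (k + 1) X
        ((settingOfRecord₁₃ F N θ.toStage13Params p).lf.alpha0 ((settingOfRecord₁₃ F N θ.toStage13Params p).flow.g (k + 1)))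
        ((settingOfRecord₁₃ F N θ.toStage13Params p).lf.alpha1 ((settingOfRecord₁₃ F N θ.toStage13Params p).flow.g (k + 1))) →
      ‖(tT s).E (k + 1) X z g φ‖ ≤ (settingOfRecord₁₃ F N θ.toStage13Params p).lf.E₀ *
        Real.exp (-((1 + 4 * (settingOfRecord₁₃ F N θ.toStage13Params p).βc) * (settingOfRecord₁₃ F N θ.toStage13Params p).lf.κ) *
          (Sect2.domSys (F.P p.K) θ.τ9.M (k + 1)).dj X))
    (hanE : ∀ s : SeqOfRecord F θ.ν θ.τ9.M (gOfRecord₁₃ F N θ.toStage13Params p) p.K (k + 1), s.Ω (k + 1) = ∅ → ∀ X z g, 0 ≤ g →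
      g ≤ (settingOfRecord₁₃ F N θ.toStage13Params p).lf.γ →
      AnalyticOnNhd ℂ ((tT s).E (k + 1) X z g)
        ((sect2TowerOfRecord F N (FluctV N) p.K (settingOfRecord₁₃ F N θ.toStage13Params p) (θ.rzAt p s) s (tT s)).space (k + 1) X
          ((settingOfRecord₁₃ F N θ.toStage13Params p).lf.alpha0 ((settingOfRecord₁₃ F N θ.toStage13Params p).flow.g (k + 1)))
          ((settingOfRecord₁₃ F N θ.toStage13Params p).lf.alpha1 ((settingOfRecord₁₃ F N θ.toStage13Params p).flow.g (k + 1)))))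
    (hEk : ∀ s : SeqOfRecord F θ.ν θ.τ9.M (gOfRecord₁₃ F N θ.toStage13Params p) p.K (k + 1), s.Ω (k + 1) = ∅ → EkT s = Ek s.init)
    (hqloc : ∀ s : SeqOfRecord F θ.ν θ.τ9.M (gOfRecord₁₃ F N θ.toStage13Params p) p.K (k + 1), s.Ω (k + 1) = ∅ →
      ∀ j, j < k → ∀ ω ω' : MultiCfg (F.P p.K) (SU N) (FluctV N), (∀ i, i ≤ k → ω i = ω' i) →
        (θ.zhAt p s).quad j (s.init.Λ (j + 1)) ω = (θ.zhAt p s).quad j (s.init.Λ (j + 1)) ω')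
    (hpre : ∀ s : SeqOfRecord F θ.ν θ.τ9.M (gOfRecord₁₃ F N θ.toStage13Params p) p.K (k + 1), s.Ω (k + 1) = ∅ →
      ∀ j, j < k → (θ.zhAt p s).ζ0 j = (θ.zhAt p s.init).ζ0 j ∧ (θ.zhAt p s).quad j = (θ.zhAt p s.init).quad j)
    (hA : ∀ s : SeqOfRecord F θ.ν θ.τ9.M (gOfRecord₁₃ F N θ.toStage13Params p) p.K (k + 1), s.Ω (k + 1) = ∅ →
      ∀ (S : ℕ → Set (Site (F.P p.K) 0)) (a a' : Tk.MSFluct (F.P p.K) (FluctV N)) (Uf : GaugeField (F.P p.K) 0 (SU N)), (∀ i, i ≤ k → a i = a' i) →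
      (sect2ActionDataOfRecord F N (FluctV N) p.K (settingOfRecord₁₃ F N θ.toStage13Params p) (θ.rzAt p s.init) s.init (t s.init) (S, a) (Ek s.init)).action23 k Uf =
        (sect2ActionDataOfRecord F N (FluctV N) p.K (settingOfRecord₁₃ F N θ.toStage13Params p) (θ.rzAt p s.init) s.init (t s.init) (S, a') (Ek s.init)).action23 k Uf)
    (hZ : ∀ s : SeqOfRecord F θ.ν θ.τ9.M (gOfRecord₁₃ F N θ.toStage13Params p) p.K (k + 1), s.Ω (k + 1) = ∅ →
      ∀ (V' : GaugeField (F.P p.K) (k + 1) (SU N)) (U₀ : GaugeField (F.P p.K) k (SU N)),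
      (θ.zhAt p s).ζ0 k Set.univ (pairCfgAt (V := FluctV N) k V' U₀) =
        chiSeqOfRecord F N θ.ν θ.τ9.M (gOfRecord₁₃ F N θ.toStage13Params p) p.K k s.init U₀ *
          wOfRecord₉ F N θ.toStage9Params p (gOfRecord₁₃ F N θ.toStage13Params p) k s U₀ ((avOfRecord F N p.K k).avg U₀))
    (hq : ∀ s : SeqOfRecord F θ.ν θ.τ9.M (gOfRecord₁₃ F N θ.toStage13Params p) p.K (k + 1), s.Ω (k + 1) = ∅ →
      ∀ (V' : GaugeField (F.P p.K) (k + 1) (SU N)) (U₀ : GaugeField (F.P p.K) k (SU N)), (θ.zhAt p s).quad k ∅ (pairCfgAt (V := FluctV N) k V' U₀) = 0)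
    (hmB : ∀ s : SeqOfRecord F θ.ν θ.τ9.M (gOfRecord₁₃ F N θ.toStage13Params p) p.K (k + 1), s.Ω (k + 1) = ∅ →
      ∀ S ∈ admSOfRecord F θ.ν θ.τ9.M (gOfRecord₁₃ F N θ.toStage13Params p) p.K k s.init,
      Measurable fun U₀ : GaugeField (F.P p.K) k (SU N) =>
        tkBranchOfRecord F N (FluctV N) θ.ν θ.τ9.M _ p.K (WtOfRecord₁₃H F N θ p s) s.init S k
          (fun ω => sect2Operand F N (FluctV N) p.K (settingOfRecord₁₃ F N θ.toStage13Params p) (θ.rzAt p s.init) s.init (t s.init) (Ek s.init)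
            (UbgOfRecord₁₃CoP F N θ.toStage13Params p k s.init) (S, fun j => (ω j).2) (fun j => (ω j).1))
          (baseCfg (V := FluctV N) k U₀))
    (hIB : ∀ s : SeqOfRecord F θ.ν θ.τ9.M (gOfRecord₁₃ F N θ.toStage13Params p) p.K (k + 1), s.Ω (k + 1) = ∅ →
      ∀ S ∈ admSOfRecord F θ.ν θ.τ9.M (gOfRecord₁₃ F N θ.toStage13Params p) p.K k s.init,
      Integrable (fun U₀ : GaugeField (F.P p.K) k (SU N) =>
        tkBranchOfRecord F N (FluctV N) θ.ν θ.τ9.M _ p.K (WtOfRecord₁₃H F N θ p s) s.init S k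
          (fun ω => sect2Operand F N (FluctV N) p.K (settingOfRecord₁₃ F N θ.toStage13Params p) (θ.rzAt p s.init) s.init (t s.init) (Ek s.init)
            (UbgOfRecord₁₃CoP F N θ.toStage13Params p k s.init) (S, fun j => (ω j).2) (fun j => (ω j).1))
          (baseCfg (V := FluctV N) k U₀)) (fieldMeasure (F.P p.K) k (SU N)))
    (hexp : ∀ s : SeqOfRecord F θ.ν θ.τ9.M (gOfRecord₁₃ F N θ.toStage13Params p) p.K (k + 1), s.Ω (k + 1) ≠ ∅ →
      Sect2.LawsT (sect2TowerOfRecord F N (FluctV N) p.K (settingOfRecord₁₃ F N θ.toStage13Params p) (θ.rzAt p s) s (tT s))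
          (settingOfRecord₁₃ F N θ.toStage13Params p).lf (settingOfRecord₁₃ F N θ.toStage13Params p).βc k ∧
        (slotsTOfRecord F N θ.ν θ.τ9 (EOfRecord₁₃ F N θ.toStage13Params) (wOfRecord₉ F N θ.toStage9Params) θ.ppSel p
            (gOfRecord₁₃ F N θ.toStage13Params p) (k + 1) s = 0 ∨
          ∀ᵐ V' ∂fieldMeasure (F.P p.K) (k + 1) (SU N),
            chiSeqOfRecord F N θ.ν θ.τ9.M (gOfRecord₁₃ F N θ.toStage13Params p) p.K (k + 1) s V' ≠ 0 →
              slotsTOfRecord F N θ.ν θ.τ9 (EOfRecord₁₃ F N θ.toStage13Params) (wOfRecord₉ F N θ.toStage9Params) θ.ppSel p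
                  (gOfRecord₁₃ F N θ.toStage13Params p) (k + 1) s V' =
                sect2Slot F N (FluctV N) p.K (settingOfRecord₁₃ F N θ.toStage13Params p) (θ.rzAt p s) (WtOfRecord₁₃H F N θ p s) s (tT s) (EkT s)
                  (UbgOfRecord₁₃CoP F N θ.toStage13Params p (k + 1) s) V')) :
    SLaw₁₃CoPH F N θ p (k + 1) :=
  sLaw₁₃CoPH_succ_of_tLaw₁₃CoPH_of_liveSel_of_rstep F N θ p (fun q j _ hj => h.rstep q j hj) hθ hκ hE₀ hB₀ hsel k hk
    (tLaw₁₃CoPH_of_formAtZS_of_newTerms_of_expansion_of_integrable θ p h hk hM hB₀ t Ek hS tT EkT huT hold hnoR hnoB hlocE hinvE hbdE hanE hEk hqloc hpre hA hZ hq hmB hIB hexp)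

end Reduction

end Summit.QuantumFields.YangMills.Theorems.BalabanUVNodesN11NoExpansionStepReductionIntegrableCoPH

end
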